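import Literature.Computability.AlgebraicComplexity.IK2020TableauLiftingAlphabet
import HarnessLib

/-!
# Ikenmeyer–Kandasamy 2020, §17: a leftpart made of uniform `m × D` blocks (`D` even) is duplex

References: C. Ikenmeyer, U. Kandasamy, arXiv:1911.03990 (bib key `IkenmeyerKandasamy2019`), §17,
proof of part (2) of Thm. 13.1 (TeX L2275–2290; chunk p0025.txt:L22–35): "A rectangular tableau
whose columns all coincide is called uniform. In the following proof we will crucially use that a
uniform tableau with an even number of columns is duplex. … if `φ(T)` is regular, then for every
block edge `e`: `φ(B̌_e)` is uniform … hence [`leftpart(φ(T))` is duplex] by construction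
(`leftpart(T) = ∑_i ∑_e B̌_e`)."

Brick of the `IK2020_thm_13_1` program (route note HOME/bip/NOTE-t08g4-IK2020Thm131-route.md, E4),
on E1 (`AC/IK2020TableauLiftingAlphabet.lean`, `isDuplex_rectTableau_iff`). Theorem-only; the
route-note caveat (two different blocks may produce the same column — the multiplicity is then a
sum of `D`'s, still even) is exactly what the proof below handles. No facts; net debt 0.
-/

namespace Literature.Computability.AlgebraicComplexity

namespace IK2020

open Finset

variable {α : Type*} {m b D : ℕ}

/-- The columns of a block rectangle: column `(k, t)` (block `k < b`, position `t < D`, linear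
index `finProdFinEquiv (k, t) = t + D k`… as Mathlib orders it) in terms of the linear index.
[cite: IkenmeyerKandasamy2019, §15] -/
theorem apply_eq_of_uniform_blocks (L : Fin (b * D) → Fin m → α) (col : Fin b → Fin m → α)
    (hL : ∀ k t, L (finProdFinEquiv (k, t)) = col k) (c : Fin (b * D)) :
    L c = col (finProdFinEquiv.symm c).1 := by
  conv_lhs => rw [← finProdFinEquiv.apply_symm_apply c]
  exact hL _ _

/-- **A rectangle that is a concatenation of uniform `m × D` blocks, `D` even, is duplex**: if the
`D` columns of each block `k < b` of `leftpart` all equal `col k`, then every column of `leftpart`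
occurs `D · #{k' | col k' = col k}` times, an even number (§17, chunk p0025.txt:L24–35; applied to
`leftpart(φ(T)) = ∑ φ(B̌_e)` with every `φ(B̌_e)` uniform, properties (I)–(III)).
[cite: IkenmeyerKandasamy2019, §17] -/
theorem isDuplex_rectTableau_of_uniform_blocks [DecidableEq α] (hD : Even D)
    (L : Fin (b * D) → Fin m → α) (col : Fin b → Fin m → α)
    (hL : ∀ k t, L (finProdFinEquiv (k, t)) = col k) : (rectTableau L).IsDuplex := by
  rw [isDuplex_rectTableau_iff]
  intro c
  have hLc : ∀ c', L c' = col (finProdFinEquiv.symm c').1 := apply_eq_of_uniform_blocks L col hL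
  have hset : univ.filter (fun c' => L c' = L c) =
      ((univ.filter fun k => col k = col (finProdFinEquiv.symm c).1) ×ˢ (univ : Finset (Fin D))).map
        finProdFinEquiv.toEmbedding := by
    ext c'
    simp only [mem_filter, mem_univ, true_and, mem_map_equiv, mem_product, and_true, hLc]
  rw [hset, card_map, card_product, card_univ, Fintype.card_fin]
  exact hD.mul_left _

/-- The multiplicity of a column in a concatenation of uniform blocks: `D · #{k' | col k' = col k}`.
[cite: IkenmeyerKandasamy2019, §17] -/
theorem card_filter_eq_of_uniform_blocks [DecidableEq α]
    (L : Fin (b * D) → Fin m → α) (col : Fin b → Fin m → α)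
    (hL : ∀ k t, L (finProdFinEquiv (k, t)) = col k) (c : Fin (b * D)) :
    (univ.filter fun c' => L c' = L c).card =
      (univ.filter fun k => col k = col (finProdFinEquiv.symm c).1).card * D := by
  have hLc : ∀ c', L c' = col (finProdFinEquiv.symm c').1 := apply_eq_of_uniform_blocks L col hL
  have hset : univ.filter (fun c' => L c' = L c) =
      ((univ.filter fun k => col k = col (finProdFinEquiv.symm c).1) ×ˢ (univ : Finset (Fin D))).map
        finProdFinEquiv.toEmbedding := by
    ext c'
    simp only [mem_filter, mem_univ, true_and, mem_map_equiv, mem_product, and_true, hLc]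
  rw [hset, card_map, card_product, card_univ, Fintype.card_fin]

/-- **Relabelled form** (the one used in §17): if for a map `φ` of the alphabet every block of
`φ(leftpart)` is uniform, then `leftpart(φ(T))` is duplex (`D` even).
[cite: IkenmeyerKandasamy2019, §17] -/
theorem isDuplex_rectTableau_relabel_of_uniform_blocks {β : Type*} [DecidableEq β] (hD : Even D)
    (L : Fin (b * D) → Fin m → α) (φ : α → β) (col : Fin b → Fin m → β)
    (hL : ∀ k t r, φ (L (finProdFinEquiv (k, t)) r) = col k r) :
    (rectTableau fun c r => φ (L c r)).IsDuplex :=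
  isDuplex_rectTableau_of_uniform_blocks hD (fun c r => φ (L c r)) col fun k t => funext (hL k t)

end IK2020

end Literature.Computability.AlgebraicComplexity
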